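import Mathlib.Analysis.SpecialFunctions.Pow.Real
import Mathlib.Analysis.SpecialFunctions.Sqrt
import Mathlib.Topology.Order.IntermediateValue
import HarnessLib

/-!
# `TwTipContinuation` (stmt-HubbardSuperconductivity-1700), line `isogap-submodular-transport`,
# stub `stub_edgeOrder` — piece 3b(iii): regularised BCS coherence factors (real analysis)

For a level with reduced energy `ξ`, d-wave factor `g` and gap parameter `D > 0` put
`r = √(ξ² + D²g² + D⁴)` (a REGULARISED quasiparticle energy: `r ≥ |ξ|`, `r ≥ D²`, so nothing
degenerates on the nodal lines `g = 0`), `u = √((1 + ξ/r)/2)`, `v = sgn(g) √((1 − ξ/r)/2)`.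
Elementary facts consumed by the BCS trial-state energy estimate:
* `u² + v² = 1`, `2v² = 1 − ξ/r ∈ [0, 2]`;
* pairing: `g u v ≥ D g²/(2r)`;
* kinetic excess: `ξ v² − min(ξ, 0) ≤ (D²g² + D⁴)/(4r)`;
* number fluctuation: `4v² − 4v⁴ ≤ 1`; occupation tails `1 − ξ/r ≤ (D²g²+D⁴)/(2ξ²)` (`ξ > 0`) and
  `1 − ξ/r ≥ 2 − (D²g²+D⁴)/(2ξ²)` (`ξ < 0`); continuity of `μ ↦ 1 − (ε−μ)/r(ε−μ)`.
Folklore (Bardeen–Cooper–Schrieffer 1957 §II coherence factors, with the regulator `D⁴`).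
-/

noncomputable section

namespace Summit.HubbardSuperconductivity.TwTipContinuation.IsogapTransport

open Real

/-! ### The regularised quasiparticle energy -/

/-- `r² = ξ² + D²g² + D⁴ ≥ 0`. [folklore] -/
theorem regE_sq_nonneg (ξ g D : ℝ) : 0 ≤ ξ ^ 2 + D ^ 2 * g ^ 2 + D ^ 4 := by positivity

/-- `r > 0` for `D ≠ 0`. [folklore] -/
theorem regE_pos (ξ g : ℝ) {D : ℝ} (hD : 0 < D) : 0 < Real.sqrt (ξ ^ 2 + D ^ 2 * g ^ 2 + D ^ 4) :=
  Real.sqrt_pos.2 (by positivity)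

/-- `|ξ| ≤ r`. [folklore] -/
theorem abs_le_regE (ξ g D : ℝ) : |ξ| ≤ Real.sqrt (ξ ^ 2 + D ^ 2 * g ^ 2 + D ^ 4) :=
  Real.abs_le_sqrt (by nlinarith [sq_nonneg (D * g), sq_nonneg (D ^ 2)])

/-- `D² ≤ r`. [folklore] -/
theorem sq_le_regE (ξ g D : ℝ) : D ^ 2 ≤ Real.sqrt (ξ ^ 2 + D ^ 2 * g ^ 2 + D ^ 4) := by
  have h := Real.abs_le_sqrt (x := D ^ 2) (y := ξ ^ 2 + D ^ 2 * g ^ 2 + D ^ 4)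
    (by nlinarith [sq_nonneg ξ, sq_nonneg (D * g)])
  rwa [abs_of_nonneg (sq_nonneg D)] at h

/-- `−1 ≤ ξ/r ≤ 1`. [folklore] -/
theorem div_regE_mem (ξ g : ℝ) {D : ℝ} (hD : 0 < D) :
    -1 ≤ ξ / Real.sqrt (ξ ^ 2 + D ^ 2 * g ^ 2 + D ^ 4) ∧ ξ / Real.sqrt (ξ ^ 2 + D ^ 2 * g ^ 2 + D ^ 4) ≤ 1 := by
  have hr := regE_pos ξ g hD
  have ha := abs_le_regE ξ g D
  rw [abs_le] at ha
  constructor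
  · rw [le_div_iff₀ hr]; linarith
  · rw [div_le_one hr]; linarith

/-! ### The coherence factors -/

/-- `u² = (1 + ξ/r)/2`. [folklore] -/
theorem cohU_sq (ξ g : ℝ) {D : ℝ} (hD : 0 < D) :
    Real.sqrt ((1 + ξ / Real.sqrt (ξ ^ 2 + D ^ 2 * g ^ 2 + D ^ 4)) / 2) ^ 2 =
      (1 + ξ / Real.sqrt (ξ ^ 2 + D ^ 2 * g ^ 2 + D ^ 4)) / 2 :=
  Real.sq_sqrt (by linarith [(div_regE_mem ξ g hD).1])

/-- `v² = (1 − ξ/r)/2`. [folklore] -/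
theorem cohV_sq (ξ g : ℝ) {D : ℝ} (hD : 0 < D) :
    ((if 0 ≤ g then 1 else -1) * Real.sqrt ((1 - ξ / Real.sqrt (ξ ^ 2 + D ^ 2 * g ^ 2 + D ^ 4)) / 2)) ^ 2 =
      (1 - ξ / Real.sqrt (ξ ^ 2 + D ^ 2 * g ^ 2 + D ^ 4)) / 2 := by
  rw [mul_pow, Real.sq_sqrt (by linarith [(div_regE_mem ξ g hD).2])]
  split_ifs <;> ring

/-- **Normalisation** `u² + v² = 1`. [folklore] -/
theorem cohU_sq_add_cohV_sq (ξ g : ℝ) {D : ℝ} (hD : 0 < D) :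
    Real.sqrt ((1 + ξ / Real.sqrt (ξ ^ 2 + D ^ 2 * g ^ 2 + D ^ 4)) / 2) ^ 2 +
      ((if 0 ≤ g then 1 else -1) * Real.sqrt ((1 - ξ / Real.sqrt (ξ ^ 2 + D ^ 2 * g ^ 2 + D ^ 4)) / 2)) ^ 2 = 1 := by
  rw [cohU_sq ξ g hD, cohV_sq ξ g hD]; ring

/-- **Pairing amplitude of a level**: `g u v ≥ D g²/(2r)`. [folklore] -/
theorem pairing_ge (ξ g : ℝ) {D : ℝ} (hD : 0 < D) :
    D * g ^ 2 / (2 * Real.sqrt (ξ ^ 2 + D ^ 2 * g ^ 2 + D ^ 4)) ≤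
      g * Real.sqrt ((1 + ξ / Real.sqrt (ξ ^ 2 + D ^ 2 * g ^ 2 + D ^ 4)) / 2) *
        ((if 0 ≤ g then 1 else -1) * Real.sqrt ((1 - ξ / Real.sqrt (ξ ^ 2 + D ^ 2 * g ^ 2 + D ^ 4)) / 2)) := by
  set r := Real.sqrt (ξ ^ 2 + D ^ 2 * g ^ 2 + D ^ 4) with hr
  have hrpos : 0 < r := regE_pos ξ g hD
  obtain ⟨h1, h2⟩ := div_regE_mem ξ g hD
  have hr2 : r ^ 2 = ξ ^ 2 + D ^ 2 * g ^ 2 + D ^ 4 := by rw [hr]; exact Real.sq_sqrt (regE_sq_nonneg ξ g D)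
  -- `√((1+ξ/r)/2) √((1−ξ/r)/2) = √(D²g²+D⁴)/(2r)`
  have hprod : Real.sqrt ((1 + ξ / r) / 2) * Real.sqrt ((1 - ξ / r) / 2) = Real.sqrt (D ^ 2 * g ^ 2 + D ^ 4) / (2 * r) := by
    rw [← Real.sqrt_mul (by linarith)]
    have : (1 + ξ / r) / 2 * ((1 - ξ / r) / 2) = (D ^ 2 * g ^ 2 + D ^ 4) / (2 * r) ^ 2 := by
      field_simp
      nlinarith [hr2]
    rw [this, Real.sqrt_div (by positivity), Real.sqrt_sq (by positivity)]
  -- `|g| √(D²g² + D⁴) ≥ D g²`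
  have habs : D * g ^ 2 ≤ |g| * Real.sqrt (D ^ 2 * g ^ 2 + D ^ 4) := by
    have h3 : D * |g| ≤ Real.sqrt (D ^ 2 * g ^ 2 + D ^ 4) := by
      apply Real.le_sqrt_of_sq_le
      rw [mul_pow, sq_abs]
      nlinarith [sq_nonneg (D ^ 2)]
    calc D * g ^ 2 = |g| * (D * |g|) := by rw [← sq_abs]; ring
      _ ≤ |g| * Real.sqrt (D ^ 2 * g ^ 2 + D ^ 4) := mul_le_mul_of_nonneg_left h3 (abs_nonneg g)
  have hsgn : g * (if 0 ≤ g then 1 else -1 : ℝ) = |g| := by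
    split_ifs with h
    · rw [mul_one, abs_of_nonneg h]
    · rw [mul_neg_one, abs_of_neg (not_le.1 h)]
  calc D * g ^ 2 / (2 * r) ≤ |g| * Real.sqrt (D ^ 2 * g ^ 2 + D ^ 4) / (2 * r) := by gcongr
    _ = |g| * (Real.sqrt ((1 + ξ / r) / 2) * Real.sqrt ((1 - ξ / r) / 2)) := by rw [hprod]; ring
    _ = _ := by rw [← hsgn]; ring

/-- **Kinetic excess of a level**: `ξ v² − min(ξ,0) ≤ (D²g² + D⁴)/(4r)`. [folklore] -/
theorem kinetic_excess_le (ξ g : ℝ) {D : ℝ} (hD : 0 < D) :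
    ξ * ((1 - ξ / Real.sqrt (ξ ^ 2 + D ^ 2 * g ^ 2 + D ^ 4)) / 2) - min ξ 0 ≤
      (D ^ 2 * g ^ 2 + D ^ 4) / (4 * Real.sqrt (ξ ^ 2 + D ^ 2 * g ^ 2 + D ^ 4)) := by
  set r := Real.sqrt (ξ ^ 2 + D ^ 2 * g ^ 2 + D ^ 4) with hr
  have hrpos : 0 < r := regE_pos ξ g hD
  have hr2 : r ^ 2 = ξ ^ 2 + D ^ 2 * g ^ 2 + D ^ 4 := by rw [hr]; exact Real.sq_sqrt (regE_sq_nonneg ξ g D)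
  have ha := abs_le_regE ξ g D
  rw [← hr, abs_le] at ha
  -- `ξ v² − min(ξ,0) = |ξ|(r − |ξ|)/(2r)` and `2|ξ|(r−|ξ|) ≤ (r−|ξ|)(r+|ξ|)`
  rw [div_eq_mul_inv (D ^ 2 * g ^ 2 + D ^ 4), show (D ^ 2 * g ^ 2 + D ^ 4) = r ^ 2 - ξ ^ 2 by rw [hr2]; ring]
  rcases le_total 0 ξ with hξ | hξ
  · rw [min_eq_right hξ, sub_zero]
    rw [show ξ * ((1 - ξ / r) / 2) = ξ * (r - ξ) / (2 * r) by field_simp]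
    rw [show (r ^ 2 - ξ ^ 2) * (4 * r)⁻¹ = (r - ξ) * (r + ξ) / (4 * r) by ring]
    rw [div_le_div_iff₀ (by positivity) (by positivity)]
    nlinarith [mul_nonneg hξ (sub_nonneg.2 ha.2), sq_nonneg (r - ξ)]
  · rw [min_eq_left hξ]
    rw [show ξ * ((1 - ξ / r) / 2) - ξ = (-ξ) * (r + ξ) / (2 * r) by field_simp; ring]
    rw [show (r ^ 2 - ξ ^ 2) * (4 * r)⁻¹ = (r + ξ) * (r - ξ) / (4 * r) by ring]
    rw [div_le_div_iff₀ (by positivity) (by positivity)]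
    nlinarith [mul_nonneg (neg_nonneg.2 hξ) (by linarith : (0 : ℝ) ≤ r + ξ), sq_nonneg (r + ξ)]

/-- **Number fluctuation of a level**: `4v² − 4v⁴ ≤ 1` (`4u²v² ≤ (u²+v²)² = 1`). [folklore] -/
theorem fluctuation_le_one (ξ g : ℝ) {D : ℝ} (hD : 0 < D) :
    4 * ((if 0 ≤ g then 1 else -1) * Real.sqrt ((1 - ξ / Real.sqrt (ξ ^ 2 + D ^ 2 * g ^ 2 + D ^ 4)) / 2)) ^ 2 -
      4 * ((if 0 ≤ g then 1 else -1) * Real.sqrt ((1 - ξ / Real.sqrt (ξ ^ 2 + D ^ 2 * g ^ 2 + D ^ 4)) / 2)) ^ 4 ≤ 1 := by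
  have key := cohV_sq ξ g hD
  set V := (if 0 ≤ g then 1 else -1) * Real.sqrt ((1 - ξ / Real.sqrt (ξ ^ 2 + D ^ 2 * g ^ 2 + D ^ 4)) / 2) with hV
  clear_value V
  have h4 : V ^ 4 = (V ^ 2) ^ 2 := by ring
  rw [h4, key]
  nlinarith [sq_nonneg (ξ / Real.sqrt (ξ ^ 2 + D ^ 2 * g ^ 2 + D ^ 4))]

/-! ### Occupation tails and continuity -/

/-- `2v² = 1 − ξ/r ∈ [0,2]`. [folklore] -/
theorem occupation_mem (ξ g : ℝ) {D : ℝ} (hD : 0 < D) :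
    0 ≤ 1 - ξ / Real.sqrt (ξ ^ 2 + D ^ 2 * g ^ 2 + D ^ 4) ∧ 1 - ξ / Real.sqrt (ξ ^ 2 + D ^ 2 * g ^ 2 + D ^ 4) ≤ 2 := by
  obtain ⟨h1, h2⟩ := div_regE_mem ξ g hD
  constructor <;> linarith

/-- **Upper occupation tail**: for `ξ > 0`, `1 − ξ/r ≤ (D²g² + D⁴)/(2ξ²)`. [folklore] -/
theorem occupation_le_of_pos {ξ : ℝ} (hξ : 0 < ξ) (g : ℝ) {D : ℝ} (hD : 0 < D) :
    1 - ξ / Real.sqrt (ξ ^ 2 + D ^ 2 * g ^ 2 + D ^ 4) ≤ (D ^ 2 * g ^ 2 + D ^ 4) / (2 * ξ ^ 2) := by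
  set r := Real.sqrt (ξ ^ 2 + D ^ 2 * g ^ 2 + D ^ 4) with hr
  have hrpos : 0 < r := regE_pos ξ g hD
  have hr2 : r ^ 2 = ξ ^ 2 + D ^ 2 * g ^ 2 + D ^ 4 := by rw [hr]; exact Real.sq_sqrt (regE_sq_nonneg ξ g D)
  have ha := abs_le_regE ξ g D
  rw [← hr, abs_of_pos hξ] at ha
  rw [show 1 - ξ / r = (r - ξ) / r by field_simp, div_le_div_iff₀ hrpos (by positivity)]
  -- `(r − ξ) 2ξ² ≤ (r² − ξ²) r = (r−ξ)(r+ξ) r`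
  rw [show D ^ 2 * g ^ 2 + D ^ 4 = (r - ξ) * (r + ξ) by nlinarith [hr2]]
  nlinarith [mul_nonneg (sub_nonneg.2 ha) hξ.le, mul_nonneg (sub_nonneg.2 ha) (mul_nonneg hξ.le (sub_nonneg.2 ha))]

/-- **Lower occupation tail**: for `ξ < 0`, `2 − (D²g² + D⁴)/(2ξ²) ≤ 1 − ξ/r`. [folklore] -/
theorem le_occupation_of_neg {ξ : ℝ} (hξ : ξ < 0) (g : ℝ) {D : ℝ} (hD : 0 < D) :
    2 - (D ^ 2 * g ^ 2 + D ^ 4) / (2 * ξ ^ 2) ≤ 1 - ξ / Real.sqrt (ξ ^ 2 + D ^ 2 * g ^ 2 + D ^ 4) := by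
  have h := occupation_le_of_pos (neg_pos.2 hξ) g hD
  rw [show (-ξ) ^ 2 = ξ ^ 2 by ring, neg_div] at h
  linarith

/-- **Continuity of the occupation in the chemical potential**:
`μ ↦ 1 − (ε − μ)/√((ε − μ)² + D²g² + D⁴)` is continuous (`D ≠ 0`). [folklore] -/
theorem continuous_occupation (ε g : ℝ) {D : ℝ} (hD : 0 < D) :
    Continuous fun μ : ℝ => 1 - (ε - μ) / Real.sqrt ((ε - μ) ^ 2 + D ^ 2 * g ^ 2 + D ^ 4) := by
  refine continuous_const.sub (Continuous.div (by fun_prop) (by fun_prop) fun μ => (regE_pos (ε - μ) g hD).ne')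

/-- **Normalisation of the regularised coherence factors (piece 3b(iii) of `stub_edgeOrder`)**,
closed form: `u² + v² = 1`. [folklore] -/
theorem bcsCoherence_normalised :
    ∀ (ξ g D : ℝ), 0 < D → Real.sqrt ((1 + ξ / Real.sqrt (ξ ^ 2 + D ^ 2 * g ^ 2 + D ^ 4)) / 2) ^ 2 + ((if 0 ≤ g then 1 else -1) * Real.sqrt ((1 - ξ / Real.sqrt (ξ ^ 2 + D ^ 2 * g ^ 2 + D ^ 4)) / 2)) ^ 2 = 1 :=
  fun ξ g _ hD => cohU_sq_add_cohV_sq ξ g hD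

end Summit.HubbardSuperconductivity.TwTipContinuation.IsogapTransport
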